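/-
Copyright: lit-balaban Phase-2 proof seat p31 (gen 4).  Statement-level skeleton of a published paper; no proof claims beyond what the
kernel checks below.
-/
import Literature.MathematicalPhysics.QuantumFieldTheory.BalabanImbrieJaffe1984to88.BIJ85Eq213Adjoint
import Literature.MathematicalPhysics.QuantumFieldTheory.BalabanImbrieJaffe1984to88.BIJ88Eq211Proof

/-!
# `BalabanImbrieJaffe1984to88.BIJ88Eq210Torus` — T. Bałaban, J. Imbrie, A. Jaffe, *Effective action and cluster properties of the abelian
Higgs model*, Commun. Math. Phys. **114** (1988) 257–315 [BalabanImbrieJaffe1988]: **(2.10)** p. 261, the constraints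
`QC^{(k)}_{loc} = C^{(k)}_{loc}Q* = 0` of the localized covariance (2.9), PROVED ON THE TORUS OF RECORD for the concrete block averages
Q = [BalabanImbrieJaffe1985] (2.13), its adjoint Q*, Q^s = (2.16), Q^{s*} = (2.17), and every kernel C̃^{(k)}

statement-level skeleton of published theorems with citation tags; proofs where landed; nothing here is a claim about the Yang–Mills mass gap

PDF held: `paper:balaban1988-cmp114-bij-abelian-higgs-effective-action` (journal page = PDF page + 256); p. 261 [PDF 5] quoted from the
image re-read recorded in `BIJ88Eq211Proof` (seat p02 gen 2, `HOME/lit-balaban-r16/renders/cmp114/original-p005-x2.png`); [2] =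
[BalabanImbrieJaffe1985] pp. 304–305 (`paper:balaban1985-cmp97-bij-higgs-minimizers`, text layer re-read this session).

CITATION HEADER (lean-in-tree rule).  Part of the lit-balaban TYPED SKELETON (HOME `run/shared/lean/pub/lit-balaban/`), Phase-2 seat p31
(gen 4, free-target protocol G.5-34(d)); row **C2.Eq2.10** of `HOME/SKELETON.md` (C2 §§1–4 fold owner r18, referee ref-5).  Before this
file the row read *"kernel PROVED from (2.9) given `QQ^{s*} = I = Q^sQ*`"* (`BIJ88Sect2Statements.eq210_of`, r18, ring level, the two
identities as hypotheses).

THE PRINTED TEXT (verbatim, p. 261 [PDF 5]).  *"Next we consider C^{(k)}, the covariance of the k-th step gauge field. This is defined on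
the unit lattice T^{(k)}_{0,1}. First define C̃^{(k)}(b₁,b₂) = C^{(k)}(b₁,b₂), if dist(b₁,b₂) ≦ ¼r(e_k), 0, otherwise, (2.8) and extend by
translation invariance to T₁^{(k)}. Then put C^{(k)}_{loc} = (I − Q^{s*}Q)C̃^{(k)}(I − Q*Q^s); (2.9) this insures that C^{(k)}_{loc}, like
C^{(k)}, satisfies the constraints from the renormalization transformation and from the axial gauge conditions: QC^{(k)}_{loc} =
C^{(k)}_{loc}Q* = 0, (2.10) … (See [2, Chap. 2] for definitions of the block averaging operators Q, Q^s, and Q^e.)"*; [2] p. 304–305: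
*"We do not explicitly compute the adjoint Q*"*, (2.19) *"Furthermore, by (2.13), QQ^{s*} = I"*.

WHAT IS REPRODUCED, and how (kind «model instance»).  On the tori of the series (`Balaban1983to89.Setup`, fine bonds `PBond P j` = the unit
lattice `T₁^{(k)}` of the k-th step field, coarse bonds `PBond P (j+1)` = the L-lattice; standing range `j + 1 ≤ m + K`), with the CONCRETE
kernels Q = `BIJ85Eq213Adjoint.qKer` (the kernel of [2] (2.13) = `LatticeFieldCalculus.bondAvg`), Q* = `BIJ85Eq213Adjoint.qstKer` (its
[2] (2.14)-adjoint), Q^s = `BIJ88Eq211Proof.qsKer`, Q^{s*} = `BIJ88Eq211Proof.qsstKer` of the torus geometry `BIJ85Eq219Proof.torusBlockBonds`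
([2] (2.16)–(2.17)): (i) the two identities behind *"this insures"* AS MATRIX PRODUCTS — **`QQ^{s*} = 1`** (`qKer_mul_qsstKer`, from [2] (2.19)
= gen 1's `BIJ85Eq219Proof.bondAvg_Qsstar`) and **`Q^sQ* = 1`** (`qsKer_mul_qstKer`, from `BIJ85Eq213Adjoint.Qs_Qstar`); (ii) **(2.10) for
the kernel (2.9)** `BIJ88Eq211Proof.clocKer Q Q* Q^s Q^{s*} C̃ = (1 − Q^{s*}Q)C̃(1 − Q*Q^s)` and EVERY `C̃`: `Q·C_loc = 0` (`qKer_mul_clocKer`),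
`C_loc·Q* = 0` (`clocKer_mul_qstKer`), and in the V1 vocabulary `bondAvg (C_loc(·, b₀)) = 0` (`bondAvg_clocKer_col`); (iii) **(2.10) AS TYPED**,
`BIJ88Sect2Statements.Eq210`, in the ring of block matrices on `T₁-bonds ⊕ L-bonds` with p02's embeddings `embLU`/`embUL`/`embUU`
(`cLoc_emb_eq_embUU` strengthens `BIJ88Eq211Proof.cLoc_fromBlocks_toBlocks₁₁` to the full matrix; **`eq210_torus`**).
HONEST SCOPE.  This is the *"insures"* step only: the sandwich (2.9) kills `Q` on the left and `Q*` on the right whatever `C̃` is; that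
`C^{(k)}` itself satisfies the constraints, the truncation (2.8), the estimates (2.5)–(2.7)-style and (2.11) (p02's `BIJ88Eq211Proof`) are
not touched.  NOTHING beyond the kernel-checked statements is asserted; NOT summit progress.  Unit `lit-balaban-p31`
(literature-prover-lit-balaban-p31-g4-0), 2026-08-21.
-/

open scoped BigOperators

namespace Literature.MathematicalPhysics.QuantumFieldTheory.BalabanImbrieJaffe1984to88.BIJ88Eq210Torus

open Literature.MathematicalPhysics.QuantumFieldTheory.Balaban1983to89
open BIJ85Sect2SurfaceAverages LatticeFieldCalculus BIJ85Eq219Proof BIJ85Eq213Adjoint BIJ88Eq211Proof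

variable {P : Params} {j : ℕ}

/-! ## 1. `QQ^{s*} = 1` and `Q^sQ* = 1` as matrix identities on the torus -/

open Classical in
/-- **`QQ^{s*} = I`** ([2] (2.19), *"Furthermore, by (2.13), QQ^{s*} = I"*) as a product of the torus kernels: `qKer·qsstKer = 1` — gen 1's
`BIJ85Eq219Proof.bondAvg_Qsstar` read through `bondAvg_eq_sum_qKer`/`Qsstar_eq_sum_qsstKer`. [cite: BalabanImbrieJaffe1985, (2.19) p.305] -/
theorem qKer_mul_qsstKer (hj : j + 1 ≤ P.m + P.K) :
    qKer P j * qsstKer (torusBlockBonds P j) = 1 := by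
  ext c c'
  have h1 : (fun b => qsstKer (torusBlockBonds P j) b c')
      = (torusBlockBonds P j).Qsstar (fun c'' => if c'' = c' then 1 else 0) := by
    funext b
    rw [Qsstar_eq_sum_qsstKer]
    simp only [mul_ite, mul_one, mul_zero, Finset.sum_ite_eq', Finset.mem_univ, if_true]
  rw [Matrix.mul_apply, Matrix.one_apply, ← bondAvg_eq_sum_qKer (fun b => qsstKer (torusBlockBonds P j) b c') c, h1,
    bondAvg_Qsstar hj]

open Classical in
/-- **`Q^sQ* = I`** as a product of the torus kernels: `qsKer·qstKer = 1` — `BIJ85Eq213Adjoint.Qs_Qstar` read through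
`Qs_eq_sum_qsKer`/`Qstar_eq_sum_qstKer`. [cite: BalabanImbrieJaffe1985, (2.14) p.304] -/
theorem qsKer_mul_qstKer (hj : j + 1 ≤ P.m + P.K) :
    qsKer (torusBlockBonds P j) * qstKer P j = 1 := by
  ext c c'
  have h1 : (fun b => qstKer P j b c') = Qstar (fun c'' => if c'' = c' then 1 else 0) := by
    funext b
    rw [Qstar_eq_sum_qstKer]
    simp only [mul_ite, mul_one, mul_zero, Finset.sum_ite_eq', Finset.mem_univ, if_true]
  rw [Matrix.mul_apply, Matrix.one_apply, ← Qs_eq_sum_qsKer (torusBlockBonds P j) (fun b => qstKer P j b c') c, h1, Qs_Qstar hj]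

/-! ## 2. (2.10) for the kernel (2.9) on the torus, every `C̃` -/

open Classical in
/-- **(2.10), left constraint** p. 261 [PDF 5]: `QC^{(k)}_{loc} = 0` for `C_loc = (1 − Q^{s*}Q)C̃(1 − Q*Q^s)` ((2.9), p02's `clocKer`) with the
torus kernels and EVERY `C̃` — `Q(1 − Q^{s*}Q) = Q − (QQ^{s*})Q = 0`. [cite: BalabanImbrieJaffe1988, (2.10) p.261] -/
theorem qKer_mul_clocKer (hj : j + 1 ≤ P.m + P.K) (Ct : Matrix (PBond P j) (PBond P j) ℝ) :
    qKer P j * clocKer (qKer P j) (qstKer P j) (qsKer (torusBlockBonds P j)) (qsstKer (torusBlockBonds P j)) Ct = 0 := by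
  have h : qKer P j * (1 - qsstKer (torusBlockBonds P j) * qKer P j) = 0 := by
    rw [Matrix.mul_sub, Matrix.mul_one, ← Matrix.mul_assoc, qKer_mul_qsstKer hj, Matrix.one_mul, sub_self]
  unfold clocKer
  rw [← Matrix.mul_assoc, ← Matrix.mul_assoc, h, Matrix.zero_mul, Matrix.zero_mul]

open Classical in
/-- **(2.10), right constraint** p. 261 [PDF 5]: `C^{(k)}_{loc}Q* = 0` with the torus kernels and EVERY `C̃` —
`(1 − Q*Q^s)Q* = Q* − Q*(Q^sQ*) = 0`. [cite: BalabanImbrieJaffe1988, (2.10) p.261] -/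
theorem clocKer_mul_qstKer (hj : j + 1 ≤ P.m + P.K) (Ct : Matrix (PBond P j) (PBond P j) ℝ) :
    clocKer (qKer P j) (qstKer P j) (qsKer (torusBlockBonds P j)) (qsstKer (torusBlockBonds P j)) Ct * qstKer P j = 0 := by
  have h : (1 - qstKer P j * qsKer (torusBlockBonds P j)) * qstKer P j = 0 := by
    rw [Matrix.sub_mul, Matrix.one_mul, Matrix.mul_assoc, qsKer_mul_qstKer hj, Matrix.mul_one, sub_self]
  unfold clocKer
  rw [Matrix.mul_assoc, h, Matrix.mul_zero]

open Classical in
/-- (2.10), left constraint, in the V1 vocabulary: the (2.13) block average `LatticeFieldCalculus.bondAvg` of every column `C_loc(·, b₀)` of the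
localized covariance vanishes (*"the constraints from the renormalization transformation"*). [cite: BalabanImbrieJaffe1988, (2.10) p.261] -/
theorem bondAvg_clocKer_col (hj : j + 1 ≤ P.m + P.K) (Ct : Matrix (PBond P j) (PBond P j) ℝ) (b₀ : PBond P j) :
    bondAvg (V := ℝ)
      (fun b => clocKer (qKer P j) (qstKer P j) (qsKer (torusBlockBonds P j)) (qsstKer (torusBlockBonds P j)) Ct b b₀) = 0 := by
  funext c
  have h := congrFun (congrFun (qKer_mul_clocKer hj Ct) c) b₀
  rw [Matrix.mul_apply, Matrix.zero_apply] at h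
  rw [bondAvg_eq_sum_qKer]
  exact h

open Classical in
/-- (2.10), right constraint, in the V1 vocabulary: `C_loc` applied to the adjoint `Q*B` of any L-lattice bond field `B` vanishes,
`Σ_b C_loc(b₀, b)(Q*B)_b = 0`. [cite: BalabanImbrieJaffe1988, (2.10) p.261] -/
theorem clocKer_Qstar (hj : j + 1 ≤ P.m + P.K) (Ct : Matrix (PBond P j) (PBond P j) ℝ) (B : PBond P (j + 1) → ℝ) (b₀ : PBond P j) :
    ∑ b, clocKer (qKer P j) (qstKer P j) (qsKer (torusBlockBonds P j)) (qsstKer (torusBlockBonds P j)) Ct b₀ b * Qstar B b = 0 := by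
  have h : ∀ c, ∑ b, clocKer (qKer P j) (qstKer P j) (qsKer (torusBlockBonds P j)) (qsstKer (torusBlockBonds P j)) Ct b₀ b
      * qstKer P j b c = 0 := fun c => by
    have h' := congrFun (congrFun (clocKer_mul_qstKer hj Ct) b₀) c
    rwa [Matrix.mul_apply, Matrix.zero_apply] at h'
  simp_rw [Qstar_eq_sum_qstKer, Finset.mul_sum]
  rw [Finset.sum_comm]
  refine Finset.sum_eq_zero fun c _ => ?_
  have h'' := congrArg (· * B c) (h c)
  simp only [zero_mul, Finset.sum_mul] at h''
  rw [← h'']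
  exact Finset.sum_congr rfl fun b _ => by ring

/-! ## 3. (2.10) AS TYPED: `BIJ88Sect2Statements.Eq210` in the ring of block matrices -/

section Blocks

variable {β κ : Type*} [Fintype β] [Fintype κ] [DecidableEq β] [DecidableEq κ]

/-- The ring-level (2.9) IS the kernel (2.9) — full matrix form of `BIJ88Eq211Proof.cLoc_fromBlocks_toBlocks₁₁`: with `Q`, `Q*`, `Q^s`, `Q^{s*}`,
`C̃` embedded as blocks on `β ⊕ κ`, r18's `cLoc` is the unit-bond block matrix of p02's `clocKer` (all other blocks vanish).
[cite: BalabanImbrieJaffe1988, (2.9) p.261] -/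
theorem cLoc_emb_eq_embUU (q : Matrix κ β ℝ) (qst : Matrix β κ ℝ) (qs : Matrix κ β ℝ) (qsst : Matrix β κ ℝ) (Ct : Matrix β β ℝ) :
    BIJ88Sect2Statements.cLoc (embLU q) (embUL qst) (embLU qs) (embUL qsst) (embUU Ct) = embUU (clocKer q qst qs qsst Ct) := by
  have hprod : ∀ (M : Matrix β κ ℝ) (N : Matrix κ β ℝ),
      embUL M * embLU N = Matrix.fromBlocks (M * N) 0 0 (0 : Matrix κ κ ℝ) := by
    intro M N
    simp [embUL, embLU, Matrix.fromBlocks_multiply]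
  have hsub : ∀ A : Matrix β β ℝ, (1 : Matrix (β ⊕ κ) (β ⊕ κ) ℝ) - Matrix.fromBlocks A 0 0 (0 : Matrix κ κ ℝ)
      = Matrix.fromBlocks (1 - A) 0 0 1 := by
    intro A
    rw [← Matrix.fromBlocks_one, sub_eq_add_neg, Matrix.fromBlocks_neg, Matrix.fromBlocks_add]
    simp [sub_eq_add_neg]
  unfold BIJ88Sect2Statements.cLoc clocKer
  rw [hprod, hprod, hsub, hsub]
  simp [embUU, Matrix.fromBlocks_multiply]

/-- In the block ring, `Q·X` vanishes iff the product of the blocks `q·x` does (left factor embedded `κ × β`, right factor `β × β`).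
[cite: BalabanImbrieJaffe1988, (2.10) p.261] -/
theorem embLU_mul_embUU (q : Matrix κ β ℝ) (X : Matrix β β ℝ) :
    embLU q * embUU X = Matrix.fromBlocks (0 : Matrix β β ℝ) 0 (q * X) (0 : Matrix κ κ ℝ) := by
  simp [embLU, embUU, Matrix.fromBlocks_multiply]

/-- In the block ring, `X·Q*` is the block `x·qst`. [cite: BalabanImbrieJaffe1988, (2.10) p.261] -/
theorem embUU_mul_embUL (X : Matrix β β ℝ) (qst : Matrix β κ ℝ) :
    embUU X * embUL qst = Matrix.fromBlocks (0 : Matrix β β ℝ) (X * qst) 0 (0 : Matrix κ κ ℝ) := by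
  simp [embUU, embUL, Matrix.fromBlocks_multiply]

end Blocks

open Classical in
/-- **(2.10) AS TYPED, ON THE TORUS OF RECORD**: r18's `BIJ88Sect2Statements.Eq210 Q Q* C_loc` (`QC_loc = 0 ∧ C_locQ* = 0`) holds in the
ring of block matrices on `T₁-bonds ⊕ L-bonds` for `C_loc = cLoc Q Q* Q^s Q^{s*} C̃` ((2.9)) built from the CONCRETE torus kernels
Q = (2.13), Q* = its (2.14)-adjoint, Q^s = (2.16), Q^{s*} = (2.17) and EVERY `C̃` — the two hypotheses `QQ^{s*} = I`, `Q^sQ* = I` of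
`eq210_of` are theorems here (`qKer_mul_qsstKer`, `qsKer_mul_qstKer`). [cite: BalabanImbrieJaffe1988, (2.10) p.261] -/
theorem eq210_torus (hj : j + 1 ≤ P.m + P.K) (Ct : Matrix (PBond P j) (PBond P j) ℝ) :
    BIJ88Sect2Statements.Eq210 (embLU (qKer P j)) (embUL (qstKer P j))
      (BIJ88Sect2Statements.cLoc (embLU (qKer P j)) (embUL (qstKer P j)) (embLU (qsKer (torusBlockBonds P j)))
        (embUL (qsstKer (torusBlockBonds P j))) (embUU Ct)) := by
  rw [cLoc_emb_eq_embUU]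
  constructor
  · rw [embLU_mul_embUU, qKer_mul_clocKer hj, Matrix.fromBlocks_zero]
  · rw [embUU_mul_embUL, clocKer_mul_qstKer hj, Matrix.fromBlocks_zero]

end Literature.MathematicalPhysics.QuantumFieldTheory.BalabanImbrieJaffe1984to88.BIJ88Eq210Torus
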